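import Summits.ResolutionOfSingularities.ResolutionOfSingularities.Theorems.EquisingularLiftEquisingularLiftNatCurvilinearMultisectionPrime
import Summits.ResolutionOfSingularities.ResolutionOfSingularities.Theorems.EquisingularLiftEquisingularLiftNatMultisection
import Literature.AlgebraicGeometry.Resolution.StalkIdealLemmas
import Literature.AlgebraicGeometry.Resolution.MarkedIdealsLemmas
import HarnessLib

/-!
# [OURS · L1 W4.5(b) · EL♮(3)] Rung TOWER, (pt-ram) supplier — SCHEME GLUE: a regular `O`-flat multisection with PRESCRIBED curvilinear
# fat-point trace on the special fibre (crux `EquisingularLiftNatThree` = stmt-ResolutionOfSingularities-20148 / `EquisingularLiftNat` = stmt-…-20038)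

HONEST FRAMING. OURS (cell res-hironaka, crux chain w45b, slot W4.5(b)); NOT a statement of any manuscript; AI-written, weaker than
expert review. Helper `--supports stmt-ResolutionOfSingularities-20148 --as helper`; closes nothing. Object: the UPSTAIRS centre of a
`TowerPtRam` step (res-L1-w45b-lead-2 g2, `…NatTowerDefs` p541504; PLANNER-MEMO-g11-1 §2–§3): over a complete DVR `O`, `r : P → Spec O`
proper, a morphism `jG : G → P` into the special fibre with SURJECTIVE stalk maps (the special-fibre immersion), a closed point `y`
of `G` with `𝒪_{P, jG y}` regular of dimension `d + 1`, and an ideal sheaf `J` on `G` supported at `y` whose stalk is generated by `d`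
elements with linearly independent classes in `𝔪_{G,y}/𝔪²_{G,y}` — plus the two ring-level side conditions the assembler reads off the
model square: the kernel of the stalk map `𝒪_{P,jG y} → 𝒪_{G,y}` lies in `(ϖ)`, and `J_y` is `𝔪`-primary — THERE IS an ideal sheaf
`C` on `P` with `V(C)` REGULAR, `V(C) → Spec O` FLAT, `supp C ∩ r⁻¹{s₀} = {jG y}` and **`C|_G = J`** (`C.comap jG = J`).
= the ring core …NatCurvilinearMultisectionPrime (p546044) ∘ res-D-pv-003's `multisection_of_prime` (…NatMultisection, p509091) ∘ the
stalk criterion for equality of ideal sheaves (`ext_of_forall_stalkIdeal_eq`, `stalkIdeal_comap_eq_map_stalkMap`).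
-/

set_option linter.dupNamespace false -- mandated namespace `Summit.<Summit>.<Problem>` of this single-conjunct summit

noncomputable section

universe u

open CategoryTheory AlgebraicGeometry TopologicalSpace IsLocalRing
open Literature.AlgebraicGeometry.Resolution

namespace Summit.ResolutionOfSingularities.ResolutionOfSingularities.Cruxes.EquisingularLiftNat.Sections

/-- **Regular `O`-flat multisection with a PRESCRIBED curvilinear fat-point trace** (see the module docstring). [OURS · L1 W4.5b;
folklore assembly: Matsumura1987 Thm. 14.2 / 11.2, StacksProject 01W6 through the cited tree files] -/
theorem exists_multisection_comap_eq {O : Type} [CommRing O] [IsDomain O] [IsDiscreteValuationRing O]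
    [IsAdicComplete (maximalIdeal O) O] {P : Scheme.{0}} (r : P ⟶ Spec (.of O)) [IsProper r]
    {G : Scheme.{0}} (jG : G ⟶ P) (hjG : Function.Injective jG)
    (hGs : ∀ x : G, r (jG x) = closedPoint O) (y : G)
    (hsurj : Function.Surjective (jG.stalkMap y).hom)
    (hres : Function.Surjective ((residue (P.presheaf.stalk (jG y))).comp ((Scheme.ΓSpecIso (.of O)).inv ≫
      (Spec (.of O)).presheaf.germ ⊤ (r (jG y)) trivial ≫ r.stalkMap (jG y)).hom))
    {d : ℕ} (hd : ringKrullDim (P.presheaf.stalk (jG y)) = (d + 1 : ℕ))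
    (hreg : IsRegularLocalRing (P.presheaf.stalk (jG y)))
    (J : G.IdealSheafData) (hJsupp : (J.support : Set G) = {y})
    (ℓ : Fin d → G.presheaf.stalk y) (hℓ : ∀ i, ℓ i ∈ maximalIdeal (G.presheaf.stalk y))
    (hJ : stalkIdeal J y = Ideal.span (Set.range ℓ))
    (hli : LinearIndependent (ResidueField (G.presheaf.stalk y)) fun i => (maximalIdeal (G.presheaf.stalk y)).toCotangent ⟨ℓ i, hℓ i⟩)
    {ϖ : O} (hϖ : Irreducible ϖ)
    (hker : RingHom.ker (jG.stalkMap y).hom ≤ Ideal.span {((Scheme.ΓSpecIso (.of O)).inv ≫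
      (Spec (.of O)).presheaf.germ ⊤ (r (jG y)) trivial ≫ r.stalkMap (jG y)).hom ϖ})
    (hprim : ∃ N : ℕ, maximalIdeal (G.presheaf.stalk y) ^ N ≤ stalkIdeal J y) :
    ∃ C : P.IdealSheafData, Scheme.IsRegular C.subscheme ∧ Flat (CategoryStruct.comp C.subschemeι r) ∧
      (C.support : Set P) ∩ r ⁻¹' {closedPoint O} = {jG y} ∧ C.comap jG = J := by
  classical
  haveI := hreg
  set b := jG y with hb_def
  set π := (jG.stalkMap y).hom with hπ
  set φ := ((Scheme.ΓSpecIso (.of O)).inv ≫ (Spec (.of O)).presheaf.germ ⊤ (r b) trivial ≫ r.stalkMap b).hom with hφ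
  -- lift the generators along the surjective stalk map
  choose f hf using fun i => hsurj (ℓ i)
  have hfm : ∀ i, f i ∈ maximalIdeal (P.presheaf.stalk b) := fun i =>
    (IsLocalRing.mem_maximalIdeal _).mpr fun hu => ((IsLocalRing.mem_maximalIdeal _).mp (hℓ i)) (by
      rw [← hf i]; exact hu.map π)
  -- cotangent independence transfers upstairs (∀-form)
  have hind : ∀ c : Fin d → P.presheaf.stalk b, ∑ i, c i * f i ∈ (maximalIdeal _) ^ 2 → ∀ i, c i ∈ maximalIdeal _ := by
    refine forall_mem_maximalIdeal_of_map π f ?_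
    have h := (linearIndependent_toCotangent_iff_forall_mem ℓ hℓ).mp hli
    intro c hc
    refine h c ?_
    simpa only [hf] using hc
  have hli' : LinearIndependent (ResidueField (P.presheaf.stalk b))
      fun i => (maximalIdeal (P.presheaf.stalk b)).toCotangent ⟨f i, hfm i⟩ :=
    (linearIndependent_toCotangent_iff_forall_mem f hfm).mpr hind
  -- the prime `𝔭 = (f)` with DVR quotient
  obtain ⟨hprime, hdom, hdvr⟩ := isDiscreteValuationRing_quotient_span_range hd f hfm hli'
  set p : Ideal (P.presheaf.stalk b) := Ideal.span (Set.range f) with hp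
  haveI := hprime
  haveI := hdom
  haveI := hdvr
  -- `𝔭 ⊔ ker π = π⁻¹(J_y)` and `J_y` is `𝔪`-primary ⇒ `𝔪^N ≤ 𝔭 ⊔ (φ ϖ)` ⇒ `φ ϖ ∉ 𝔭`
  have hmap : p.map π = stalkIdeal J y := by
    rw [hp, Ideal.map_span, hJ]
    congr 1
    ext a
    constructor
    · rintro ⟨_, ⟨i, rfl⟩, rfl⟩; exact ⟨i, (hf i).symm⟩
    · rintro ⟨i, rfl⟩; exact ⟨f i, ⟨i, rfl⟩, hf i⟩
  obtain ⟨N, hN⟩ := hprim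
  haveI : IsLocalHom π := inferInstance
  have hmN : (maximalIdeal (P.presheaf.stalk b)).map π = maximalIdeal (G.presheaf.stalk y) := by
    apply le_antisymm
    · exact ((IsLocalRing.local_hom_TFAE π).out 0 2).mp ‹IsLocalHom π›
    · intro a ha
      obtain ⟨a', rfl⟩ := hsurj a
      exact Ideal.mem_map_of_mem π ((IsLocalRing.mem_maximalIdeal _).mpr fun hu =>
        ((IsLocalRing.mem_maximalIdeal _).mp ha) (hu.map π))
  have hN' : maximalIdeal (P.presheaf.stalk b) ^ N ≤ p ⊔ Ideal.span {φ ϖ} := by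
    intro a ha
    have ha' : π a ∈ stalkIdeal J y := by
      apply hN
      rw [← hmN, ← Ideal.map_pow]
      exact Ideal.mem_map_of_mem π ha
    rw [← hmap, ← Ideal.mem_comap, Ideal.comap_map_of_surjective π hsurj] at ha'
    -- `comap (map p) = p ⊔ ker`, spelled by Mathlib as `p ⊔ comap ⊥`
    rcases Submodule.mem_sup.mp ha' with ⟨u, hu, v, hv, rfl⟩
    exact Submodule.mem_sup.mpr ⟨u, hu, v, hker (by simpa [RingHom.mem_ker] using hv), rfl⟩
  have hϖp : φ ϖ ∉ p := not_mem_span_range_of_maximalIdeal_pow_le hd f hfm hli' hN'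
  have hne : ∃ a ∈ maximalIdeal O, Ideal.Quotient.mk p (φ a) ≠ 0 :=
    ⟨ϖ, (IsLocalRing.mem_maximalIdeal _).mpr hϖ.not_isUnit, fun h => hϖp ((Ideal.Quotient.eq_zero_iff_mem).mp h)⟩
  have hb : r b = closedPoint O := hGs y
  -- the multisection through `b` with stalk `𝔭`
  obtain ⟨-, -, hsf, -, hCreg, hCflat, hCst⟩ := multisection_of_prime r hb hres p hne
  refine ⟨_, hCreg, hCflat, hsf, ?_⟩
  -- `C|_G = J`: compare stalks
  set C := primeDivisorIdeal (P.fromSpecStalk b ⟨p, hprime⟩) with hC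
  apply ext_of_forall_stalkIdeal_eq
  intro x
  by_cases hx : x = y
  · subst hx
    rw [stalkIdeal_comap_eq_map_stalkMap]
    show Ideal.map π (stalkIdeal C b) = _
    rw [hCst, hmap]
  · -- off `y` both stalks are the unit ideal
    have hxJ : x ∉ J.support := by rw [← SetLike.mem_coe, hJsupp]; exact hx
    have hxC : jG x ∉ C.support := by
      intro hmem
      have : jG x ∈ (C.support : Set P) ∩ r ⁻¹' {closedPoint O} := ⟨hmem, hGs x⟩
      rw [hsf] at this
      exact hx (hjG this)
    have htopJ : stalkIdeal J x = ⊤ := by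
      by_contra h
      exact hxJ ((mem_support_iff_stalkIdeal_le J x).mpr (IsLocalRing.le_maximalIdeal h))
    have htopC : stalkIdeal C (jG x) = ⊤ := by
      by_contra h
      exact hxC ((mem_support_iff_stalkIdeal_le C (jG x)).mpr (IsLocalRing.le_maximalIdeal h))
    rw [stalkIdeal_comap_eq_map_stalkMap, htopC, htopJ, Ideal.map_top]

end Summit.ResolutionOfSingularities.ResolutionOfSingularities.Cruxes.EquisingularLiftNat.Sections

end
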